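import Literature.AlgebraicGeometry.Resolution.CoordinateBlowupProperTransform
import HarnessLib

/-!
# The ideal of the strict transform on a coordinate blow-up chart: saturation, and when the proper
# transforms of a set of generators suffice

Topic: `Literature/AlgebraicGeometry/Resolution`. Continuation of `CoordinateBlowupChart.lean`
(the standard chart over `X_{i₀}` of the blow-up of `𝔸^σ_S` along `V(X_i : i ∈ A)` is `𝔸^σ_S`
with blow-up map Hu's substitution `coordBlowupSubst : X_i ↦ X_{i₀} X_i`, `i ∈ A ∖ {i₀}`; chart
isomorphism `coordBlowupChartEquiv : S[X_σ] ≃ S[X_σ][I/X_{i₀}]`) and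
`CoordinateBlowupProperTransform.lean` (Hu's proper transform `f_𝔙 = π*(f)/ζ^l` of ONE
polynomial, Y. Hu, arXiv:2507.21400, §5 Def. 5.4, and the hypersurface case
`S[X_σ]/(f_𝔙) ≅ (S[X_σ]/(f))[Ī/X̄_{i₀}]`, Görtz–Wedhorn Prop. 13.96 (2)).

Here: SEVERAL equations. For an ideal `I ⊆ S[X_σ]` (a closed subscheme `V(I) ⊆ 𝔸^σ_S` of the
lower chart) the ideal of its strict transform on the chart is the `X_{i₀}`-SATURATION of the
total transform `π*(I) S[X_σ]`,

  `I^st := {g | ∃ N, X_{i₀}^N g ∈ π*(I) S[X_σ]}`  (`coordStrictTransformIdeal`),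

which is exactly the kernel of the surjection `S[X_σ] ≅ S[X_σ][𝔞/X_{i₀}] ↠ (S[X_σ]/I)[𝔞̄/X̄_{i₀}]`
onto the affine blowup algebra of `V(I)` (`coordStrictTransformIdeal_eq_comap_ker`, from
`blowupAlgebra.mem_ker_mapQuotient_iff` of `BlowupAlgebraStrictTransform.lean`; Görtz–Wedhorn
Prop. 13.96 (2): the strict transform of `Z ↪ X` is `Bl_{Z ∩ centre}(Z)`, a closed subscheme of
`Bl(X)`), whence **`S[X_σ]/I^st ≅ (S[X_σ]/I)[𝔞̄/X̄_{i₀}]`** (`quotientCoordStrictTransformIdealEquiv`).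
It contains the proper transform `f_𝔙` of every `f ∈ I` (`coordProperTransform_mem`), so for a
generating set `G` of `I` one has `(f_𝔙 : f ∈ G) ⊆ I^st` — but in general NOT equality: the
proper transforms of a set of generators cut out the strict transform plus, possibly, extra
components inside the exceptional divisor `(X_{i₀} = 0)`. **Criterion**
(`coordStrictTransformIdeal_span_eq_iff`): `I^st = (f_𝔙 : f ∈ G)` if and only if `X_{i₀}` is a
non-zero-divisor modulo `(f_𝔙 : f ∈ G)`. For one equation over a domain this holds
(`X_{i₀}` prime, `X_{i₀} ∤ f_𝔙`), recovering the hypersurface case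
(`coordStrictTransformIdeal_span_singleton`).

This is the hypothesis behind every statement of the form "the proper transform `Ṽ ∩ 𝔙` is
DEFINED BY the proper transforms of the defining equations" (Hu 2025, Prop. 5.16 (1),
Prop. 6.11 (1), Lemma 7.4 (1), 7.5 (1): "By applying the inductive assumption to `𝔙'`, it
suffices to prove that the proper transform of any non-governing binomial … depends on the
governing binomials"), which the source does not verify; what holds unconditionally is the
CONTAINMENT `Ṽ ∩ 𝔙 ⊆ V(f_𝔙 : f ∈ G)` (`span_image_coordProperTransform_le`).
Everything is PROVED; no named facts.

* `coordTotalTransformIdeal S A i₀ I = π*(I) S[X_σ]`, `coordStrictTransformIdeal S A i₀ I = I^st`;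
  `mem_coordStrictTransformIdeal_iff`, `coordTotalTransformIdeal_le_strict`,
  `mem_of_X_mul_mem` / `mem_of_X_pow_mul_mem` (`I^st` is saturated), `coordStrictTransformIdeal_mono`;
* `coordProperTransform_mem`, `span_image_coordProperTransform_le` — `f_𝔙 ∈ I^st` for `f ∈ I`;
* `coordTotalTransformIdeal_span_le` — `π*(G) ⊆ (f_𝔙 : f ∈ G)`;
* `coordStrictTransformIdeal_span_eq_of_forall_mem`, `coordStrictTransformIdeal_span_eq_iff` —
  **the criterion**; `coordStrictTransformIdeal_span_singleton` — one equation over a domain;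
* `coordStrictTransformIdeal_eq_comap_ker`, `map_coordStrictTransformIdeal_eq_ker`,
  `quotientCoordStrictTransformIdealEquiv` (+ `_mk`) — **the anchoring in the blow-up of `V(I)`**;
  `quotientSpanProperTransformsEquiv` — under the criterion, `S[X_σ]/(f_𝔙 : f ∈ G)` is the chart
  ring of the blow-up of `V(G)`;
* `coordStrictTransformIdeal_eq_top_of_X_mem` — if `X_{i₀} ∈ I` (the subscheme lies in the
  hyperplane the chart lies over) the strict transform is EMPTY on this chart;
  `isDomain_quotient_coordStrictTransformIdeal`, `coordStrictTransformIdeal_isPrime_or_eq_top` —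
  **the strict transform of an integral subscheme is integral (or empty) on the chart**: for `I`
  prime, `I^st` is prime or `⊤`.

## Sources

* U. Görtz, T. Wedhorn, *Algebraic Geometry I*, 2nd ed. (2020), Prop. 13.96 (2) and the paragraph
  after it, p. 416 (strict transform as the blow-up of the restricted centre; the affine blowup
  algebra (13.19), p. 415). [GortzWedhorn2020]
* Y. Hu, *Universal characteristic-free resolution of singularities, I*, arXiv:2507.21400 (2025),
  §5 Def. 5.4 (proper transforms), Prop. 5.16 (1) (the "defined by" statements). [Hu2025]
-/

noncomputable section

open MvPolynomial

namespace Literature.AlgebraicGeometry.Resolution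

universe u v

variable (S : Type u) [CommRing S] {σ : Type v} (A : Set σ) (i₀ : σ)

/-! ### Total and strict transform ideals -/

/-- **The total transform** `π*(I) S[X_σ]` of an ideal of the lower chart: its extension along
Hu's substitution `X_i ↦ X_{i₀} X_i` (`i ∈ A ∖ {i₀}`). [cite: GortzWedhorn2020, Prop. 13.96 (2) and p. 416] -/
def coordTotalTransformIdeal (I : Ideal (MvPolynomial σ S)) : Ideal (MvPolynomial σ S) :=
  I.map (coordBlowupSubst S A i₀ : MvPolynomial σ S →+* MvPolynomial σ S)

/-- **The strict transform ideal** `I^st = {g | ∃ N, X_{i₀}^N g ∈ π*(I) S[X_σ]}`: the saturation of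
the total transform by the exceptional equation `ζ = X_{i₀}` of the chart.
[cite: GortzWedhorn2020, Prop. 13.96 (2) and p. 416] -/
def coordStrictTransformIdeal (I : Ideal (MvPolynomial σ S)) : Ideal (MvPolynomial σ S) where
  carrier := {g | ∃ N : ℕ, X i₀ ^ N * g ∈ coordTotalTransformIdeal S A i₀ I}
  zero_mem' := ⟨0, by rw [mul_zero]; exact Ideal.zero_mem _⟩
  add_mem' := by
    rintro f g ⟨N, hN⟩ ⟨M, hM⟩
    refine ⟨N + M, ?_⟩
    rw [mul_add]
    refine Ideal.add_mem _ ?_ ?_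
    · rw [pow_add, mul_comm (X i₀ ^ N), mul_assoc]
      exact Ideal.mul_mem_left _ _ hN
    · rw [pow_add, mul_assoc]
      exact Ideal.mul_mem_left _ _ hM
  smul_mem' := by
    rintro c g ⟨N, hN⟩
    refine ⟨N, ?_⟩
    rw [smul_eq_mul, mul_left_comm]
    exact Ideal.mul_mem_left _ _ hN

/-- Membership in the strict transform ideal. [cite: GortzWedhorn2020, Prop. 13.96 (2) and p. 416] -/
theorem mem_coordStrictTransformIdeal_iff {I : Ideal (MvPolynomial σ S)} {g : MvPolynomial σ S} :
    g ∈ coordStrictTransformIdeal S A i₀ I ↔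
      ∃ N : ℕ, X i₀ ^ N * g ∈ coordTotalTransformIdeal S A i₀ I :=
  Iff.rfl

/-- The total transform lies in the strict transform ideal (`N = 0`). [folklore] -/
theorem coordTotalTransformIdeal_le_strict (I : Ideal (MvPolynomial σ S)) :
    coordTotalTransformIdeal S A i₀ I ≤ coordStrictTransformIdeal S A i₀ I := fun _ hg =>
  ⟨0, by rwa [pow_zero, one_mul]⟩

/-- `π* f ∈ I^st` for `f ∈ I`. [folklore] -/
theorem coordBlowupSubst_mem {I : Ideal (MvPolynomial σ S)} {f : MvPolynomial σ S} (hf : f ∈ I) :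
    coordBlowupSubst S A i₀ f ∈ coordStrictTransformIdeal S A i₀ I :=
  coordTotalTransformIdeal_le_strict S A i₀ I (Ideal.mem_map_of_mem _ hf)

/-- **`I^st` is `X_{i₀}`-saturated**: `X_{i₀}^k g ∈ I^st → g ∈ I^st`. [folklore] -/
theorem mem_of_X_pow_mul_mem {I : Ideal (MvPolynomial σ S)} {g : MvPolynomial σ S} {k : ℕ}
    (h : X i₀ ^ k * g ∈ coordStrictTransformIdeal S A i₀ I) :
    g ∈ coordStrictTransformIdeal S A i₀ I := by
  obtain ⟨N, hN⟩ := h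
  exact ⟨N + k, by rwa [pow_add, mul_assoc]⟩

/-- `I^st` is `X_{i₀}`-saturated: `X_{i₀} g ∈ I^st → g ∈ I^st`. [folklore] -/
theorem mem_of_X_mul_mem {I : Ideal (MvPolynomial σ S)} {g : MvPolynomial σ S}
    (h : X i₀ * g ∈ coordStrictTransformIdeal S A i₀ I) :
    g ∈ coordStrictTransformIdeal S A i₀ I :=
  mem_of_X_pow_mul_mem S A i₀ (k := 1) (by rwa [pow_one])

/-- The strict transform ideal is monotone in `I`. [folklore] -/
theorem coordStrictTransformIdeal_mono {I J : Ideal (MvPolynomial σ S)} (h : I ≤ J) :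
    coordStrictTransformIdeal S A i₀ I ≤ coordStrictTransformIdeal S A i₀ J := fun _ ⟨N, hN⟩ =>
  ⟨N, Ideal.map_mono h hN⟩

/-! ### Proper transforms of members of `I` lie in `I^st` -/

/-- **`f_𝔙 ∈ I^st` for every `f ∈ I`**: `X_{i₀}^l f_𝔙 = π* f ∈ π*(I)` (Def. 5.4). In particular
the strict transform `V(I^st)` is CONTAINED in the zero set of the proper transforms of any set
of members of `I`. [cite: Hu2025, §5 Def. 5.4] -/
theorem coordProperTransform_mem (hi₀ : i₀ ∈ A) {I : Ideal (MvPolynomial σ S)}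
    {f : MvPolynomial σ S} (hf : f ∈ I) :
    coordProperTransform S A i₀ f ∈ coordStrictTransformIdeal S A i₀ I :=
  ⟨centreOrder A f, by
    rw [← coordBlowupSubst_eq_X_pow_mul_coordProperTransform S A i₀ hi₀]
    exact Ideal.mem_map_of_mem _ hf⟩

/-- For `G ⊆ I`: `(f_𝔙 : f ∈ G) ⊆ I^st`. [cite: Hu2025, §5 Def. 5.4] -/
theorem span_image_coordProperTransform_le (hi₀ : i₀ ∈ A) {I : Ideal (MvPolynomial σ S)}
    {G : Set (MvPolynomial σ S)} (hG : G ⊆ I) :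
    Ideal.span (coordProperTransform S A i₀ '' G) ≤ coordStrictTransformIdeal S A i₀ I := by
  rw [Ideal.span_le]
  rintro _ ⟨f, hf, rfl⟩
  exact coordProperTransform_mem S A i₀ hi₀ (hG hf)

/-- The total transform of `(G)` is `(π* f : f ∈ G)`. [folklore] -/
theorem coordTotalTransformIdeal_span (G : Set (MvPolynomial σ S)) :
    coordTotalTransformIdeal S A i₀ (Ideal.span G) = Ideal.span (coordBlowupSubst S A i₀ '' G) := by
  rw [coordTotalTransformIdeal, Ideal.map_span]
  rfl

/-- **`π*(G) ⊆ (f_𝔙 : f ∈ G)`**: each `π* f = X_{i₀}^l f_𝔙` is a multiple of `f_𝔙`.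
[cite: Hu2025, §5 Def. 5.4] -/
theorem coordTotalTransformIdeal_span_le (hi₀ : i₀ ∈ A) (G : Set (MvPolynomial σ S)) :
    coordTotalTransformIdeal S A i₀ (Ideal.span G) ≤
      Ideal.span (coordProperTransform S A i₀ '' G) := by
  rw [coordTotalTransformIdeal_span, Ideal.span_le]
  rintro _ ⟨f, hf, rfl⟩
  rw [SetLike.mem_coe, coordBlowupSubst_eq_X_pow_mul_coordProperTransform S A i₀ hi₀]
  exact Ideal.mul_mem_left _ _ (Ideal.subset_span ⟨f, hf, rfl⟩)

/-! ### The criterion: proper transforms of generators generate `I^st` iff `X_{i₀}` is regular modulo them -/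

/-- **Sufficiency**: if `X_{i₀}` is a non-zero-divisor modulo `(f_𝔙 : f ∈ G)` then
`(G)^st = (f_𝔙 : f ∈ G)` — the proper transforms of the generators DEFINE the strict transform.
(For `g ∈ (G)^st`, `X_{i₀}^N g ∈ π*(G) ⊆ (f_𝔙)`; peel off the powers of `X_{i₀}`.)
[cite: GortzWedhorn2020, Prop. 13.96 (2) and p. 416] -/
theorem coordStrictTransformIdeal_span_eq_of_forall_mem (hi₀ : i₀ ∈ A)
    (G : Set (MvPolynomial σ S))
    (hreg : ∀ g : MvPolynomial σ S, X i₀ * g ∈ Ideal.span (coordProperTransform S A i₀ '' G) →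
      g ∈ Ideal.span (coordProperTransform S A i₀ '' G)) :
    coordStrictTransformIdeal S A i₀ (Ideal.span G) =
      Ideal.span (coordProperTransform S A i₀ '' G) := by
  refine le_antisymm ?_ (span_image_coordProperTransform_le S A i₀ hi₀ Ideal.subset_span)
  rintro g ⟨N, hN⟩
  have hmem : X i₀ ^ N * g ∈ Ideal.span (coordProperTransform S A i₀ '' G) :=
    coordTotalTransformIdeal_span_le S A i₀ hi₀ G hN
  clear hN
  induction N with
  | zero => rwa [pow_zero, one_mul] at hmem
  | succ N ih =>
    apply ih
    apply hreg
    rwa [← mul_assoc, ← pow_succ']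

/-- **The criterion**: `(G)^st = (f_𝔙 : f ∈ G)` if and only if `X_{i₀}` is a non-zero-divisor
modulo `(f_𝔙 : f ∈ G)` (necessity: `I^st` is saturated). In words: the proper transforms of a set
of defining equations of `Z ⊆ 𝔸^σ` cut out exactly the strict transform of `Z` on the chart iff
the exceptional equation is regular modulo them; otherwise they cut out the strict transform
together with extra components inside the exceptional divisor.
[cite: GortzWedhorn2020, Prop. 13.96 (2) and p. 416] [cite: Hu2025, §5 Prop. 5.16 (1)] -/
theorem coordStrictTransformIdeal_span_eq_iff (hi₀ : i₀ ∈ A) (G : Set (MvPolynomial σ S)) :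
    coordStrictTransformIdeal S A i₀ (Ideal.span G) =
        Ideal.span (coordProperTransform S A i₀ '' G) ↔
      ∀ g : MvPolynomial σ S, X i₀ * g ∈ Ideal.span (coordProperTransform S A i₀ '' G) →
        g ∈ Ideal.span (coordProperTransform S A i₀ '' G) := by
  refine ⟨fun h g hg => ?_, coordStrictTransformIdeal_span_eq_of_forall_mem S A i₀ hi₀ G⟩
  rw [← h] at hg ⊢
  exact mem_of_X_mul_mem S A i₀ hg

/-- **One equation over a domain**: `(f)^st = (f_𝔙)` for `f ≠ 0` — `X_{i₀}` is prime and does not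
divide `f_𝔙`, so it is regular modulo `(f_𝔙)`; this is the hypersurface case of
`CoordinateBlowupProperTransform.lean` (`ker_mapQuotient_eq_span_coordProperTransform`).
[cite: GortzWedhorn2020, Prop. 13.96 (2) and p. 416] [cite: Hu2025, §5 Def. 5.4] -/
theorem coordStrictTransformIdeal_span_singleton [IsDomain S] (hi₀ : i₀ ∈ A)
    {f : MvPolynomial σ S} (hf : f ≠ 0) :
    coordStrictTransformIdeal S A i₀ (Ideal.span {f}) =
      Ideal.span {coordProperTransform S A i₀ f} := by
  have h := coordStrictTransformIdeal_span_eq_of_forall_mem S A i₀ hi₀ {f}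
  rw [Set.image_singleton] at h
  apply h
  intro g hg
  rw [Ideal.mem_span_singleton] at hg ⊢
  obtain ⟨c, hc⟩ := hg
  -- `X_{i₀}` is prime, divides `f_𝔙 c`, does not divide `f_𝔙`: it divides `c`
  have hX : Prime (X i₀ : MvPolynomial σ S) := prime_X_of_isDomain S i₀
  have hdvd : (X i₀ : MvPolynomial σ S) ∣ coordProperTransform S A i₀ f * c := ⟨g, hc.symm⟩
  rcases hX.dvd_or_dvd hdvd with h1 | h2
  · exact absurd (Ideal.mem_span_singleton.mpr h1)
      (coordProperTransform_not_mem_span_X S A i₀ hi₀ hf)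
  · obtain ⟨c', rfl⟩ := h2
    refine ⟨c', ?_⟩
    have hcancel : (X i₀ : MvPolynomial σ S) * g = X i₀ * (coordProperTransform S A i₀ f * c') := by
      rw [hc]; ring
    exact (isRegular_X (R := S) (n := i₀)).left hcancel

/-! ### Anchoring: `I^st` is the kernel of `S[X_σ] ≅ S[X_σ][𝔞/X_{i₀}] ↠ (S[X_σ]/I)[𝔞̄/X̄_{i₀}]` -/

local notation3 "𝓒" => blowupAlgebra (Ideal.span (X '' A)) (X i₀ : MvPolynomial σ S)
local notation3 "𝓮" => ((coordBlowupChartEquiv S A i₀).toRingEquiv :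
  MvPolynomial σ S →+* blowupAlgebra (Ideal.span (X '' A)) (X i₀ : MvPolynomial σ S))

/-- The total transform read through the chart isomorphism is the extension of `I` along the
structure map of the chart ring. [cite: Hu2025, §5 Prop. 5.3] -/
theorem map_coordTotalTransformIdeal (I : Ideal (MvPolynomial σ S)) :
    (coordTotalTransformIdeal S A i₀ I).map 𝓮 = I.map (algebraMap (MvPolynomial σ S) 𝓒) := by
  rw [coordTotalTransformIdeal, Ideal.map_map]
  have hcomp : (𝓮).comp (coordBlowupSubst S A i₀ : MvPolynomial σ S →+* MvPolynomial σ S) =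
      algebraMap (MvPolynomial σ S) 𝓒 :=
    RingHom.ext fun p => coordBlowupChartEquiv_coordBlowupSubst S A i₀ p
  rw [hcomp]

/-- Transfer of membership along the chart isomorphism. [folklore] -/
theorem mem_iff_coordBlowupChartEquiv_mem_map (J : Ideal (MvPolynomial σ S))
    (g : MvPolynomial σ S) : g ∈ J ↔ 𝓮 g ∈ J.map 𝓮 := by
  rw [Ideal.map_comap_of_equiv, Ideal.mem_comap]
  exact (iff_of_eq (congrArg (· ∈ J)
    ((coordBlowupChartEquiv S A i₀).toRingEquiv.symm_apply_apply g))).symm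

/-- **`I^st` is the pull-back along the chart isomorphism of the kernel of
`S[X_σ][𝔞/X_{i₀}] → (S[X_σ]/I)[𝔞̄/X̄_{i₀}]`** — the ideal of the strict transform of `V(I)` on the
chart (GW Prop. 13.96 (2): the strict transform is the blow-up of `V(I)` along the restricted
centre, a closed subscheme of the blow-up; its chart ideal is the `X_{i₀}`-saturation of
`I·S[X_σ][𝔞/X_{i₀}]`, `blowupAlgebra.mem_ker_mapQuotient_iff`).
[cite: GortzWedhorn2020, Prop. 13.96 (2) and p. 416] -/
theorem coordStrictTransformIdeal_eq_comap_ker (I : Ideal (MvPolynomial σ S)) :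
    coordStrictTransformIdeal S A i₀ I =
      (RingHom.ker (blowupAlgebra.mapQuotient (Ideal.span (X '' A)) (X i₀ : MvPolynomial σ S) I)).comap
        𝓮 := by
  ext g
  rw [Ideal.mem_comap, blowupAlgebra.mem_ker_mapQuotient_iff, mem_coordStrictTransformIdeal_iff,
    ← map_coordTotalTransformIdeal]
  have hX : algebraMap (MvPolynomial σ S) 𝓒 (X i₀) = 𝓮 (X i₀) :=
    (coordBlowupChartEquiv_X_self S A i₀).symm
  simp_rw [hX, ← map_pow, ← map_mul]
  exact exists_congr fun N => mem_iff_coordBlowupChartEquiv_mem_map S A i₀ _ (X i₀ ^ N * g)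

/-- The image of `I^st` under the chart isomorphism is that kernel. [cite: GortzWedhorn2020, Prop. 13.96 (2) and p. 416] -/
theorem map_coordStrictTransformIdeal_eq_ker (I : Ideal (MvPolynomial σ S)) :
    (coordStrictTransformIdeal S A i₀ I).map 𝓮 =
      RingHom.ker (blowupAlgebra.mapQuotient (Ideal.span (X '' A)) (X i₀ : MvPolynomial σ S) I) := by
  rw [coordStrictTransformIdeal_eq_comap_ker]
  exact Ideal.map_comap_of_surjective 𝓮 (coordBlowupChartEquiv S A i₀).surjective _

/-- **`S[X_σ]/I^st ≅ (S[X_σ]/I)[𝔞̄/X̄_{i₀}]`**: the chart over `X_{i₀}` of the blow-up of the closed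
subscheme `V(I) ⊆ 𝔸^σ_S` along `V(X_i : i ∈ A) ∩ V(I)` is `Spec S[X_σ]/I^st`, i.e. `V(I^st)` IS the
strict transform of `V(I)` on the standard chart. [cite: GortzWedhorn2020, Prop. 13.96 (2) and p. 416] -/
def quotientCoordStrictTransformIdealEquiv (I : Ideal (MvPolynomial σ S)) :
    (MvPolynomial σ S ⧸ coordStrictTransformIdeal S A i₀ I) ≃+*
      blowupAlgebra ((Ideal.span (X '' A)).map (Ideal.Quotient.mk I))
        (Ideal.Quotient.mk I (X i₀ : MvPolynomial σ S)) :=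
  (Ideal.quotientEquiv (coordStrictTransformIdeal S A i₀ I)
      (RingHom.ker (blowupAlgebra.mapQuotient (Ideal.span (X '' A)) (X i₀ : MvPolynomial σ S) I))
      (coordBlowupChartEquiv S A i₀).toRingEquiv
      (map_coordStrictTransformIdeal_eq_ker S A i₀ I).symm).trans
    (RingHom.quotientKerEquivOfSurjective
      (blowupAlgebra.mapQuotient_surjective (Ideal.span (X '' A)) (X i₀ : MvPolynomial σ S) I))

/-- The isomorphism on classes: `[p] ↦ (chart iso of p) mod I`, i.e. it is induced by the chart
map `X_i ↦ X_i/X_{i₀}` (`i ∈ A ∖ {i₀}`). [folklore] -/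
theorem quotientCoordStrictTransformIdealEquiv_mk (I : Ideal (MvPolynomial σ S))
    (p : MvPolynomial σ S) :
    quotientCoordStrictTransformIdealEquiv S A i₀ I (Ideal.Quotient.mk _ p) =
      blowupAlgebra.mapQuotient (Ideal.span (X '' A)) (X i₀ : MvPolynomial σ S) I
        (coordBlowupChartEquiv S A i₀ p) :=
  rfl

/-- **Under the criterion, the proper transforms of the generators present the chart of the
blow-up of `V(G)`**: `S[X_σ]/(f_𝔙 : f ∈ G) ≅ (S[X_σ]/(G))[𝔞̄/X̄_{i₀}]` whenever `X_{i₀}` is regular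
modulo `(f_𝔙 : f ∈ G)`. [cite: GortzWedhorn2020, Prop. 13.96 (2) and p. 416] [cite: Hu2025, §5 Prop. 5.16 (1)] -/
def quotientSpanProperTransformsEquiv (hi₀ : i₀ ∈ A) (G : Set (MvPolynomial σ S))
    (hreg : ∀ g : MvPolynomial σ S, X i₀ * g ∈ Ideal.span (coordProperTransform S A i₀ '' G) →
      g ∈ Ideal.span (coordProperTransform S A i₀ '' G)) :
    (MvPolynomial σ S ⧸ Ideal.span (coordProperTransform S A i₀ '' G)) ≃+*
      blowupAlgebra ((Ideal.span (X '' A)).map (Ideal.Quotient.mk (Ideal.span G)))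
        (Ideal.Quotient.mk (Ideal.span G) (X i₀ : MvPolynomial σ S)) :=
  (Ideal.quotEquivOfEq (coordStrictTransformIdeal_span_eq_of_forall_mem S A i₀ hi₀ G hreg).symm).trans
    (quotientCoordStrictTransformIdealEquiv S A i₀ (Ideal.span G))

/-! ### The strict transform of an integral subscheme is integral or empty -/

/-- If `X_{i₀} ∈ I` — `V(I)` lies in the coordinate hyperplane `(X_{i₀} = 0)` over which the
chart lies — then `1 = (X_{i₀})_𝔙 ∈ I^st`: the strict transform does not meet this chart.
[cite: GortzWedhorn2020, Prop. 13.96 (2) and p. 416] -/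
theorem coordStrictTransformIdeal_eq_top_of_X_mem {I : Ideal (MvPolynomial σ S)}
    (h : (X i₀ : MvPolynomial σ S) ∈ I) : coordStrictTransformIdeal S A i₀ I = ⊤ := by
  rw [Ideal.eq_top_iff_one]
  refine ⟨1, ?_⟩
  rw [pow_one, mul_one, ← coordBlowupSubst_X_self S A i₀]
  exact Ideal.mem_map_of_mem _ h

/-- **For `I` prime with `X_{i₀} ∉ I`, `S[X_σ]/I^st` is a domain**: it is the affine blowup
algebra of the domain `S[X_σ]/I` at the non-zero element `X̄_{i₀}`, a subring of the domain
`(S[X_σ]/I)[1/X̄_{i₀}]`. [cite: GortzWedhorn2020, Prop. 13.96 (2) and p. 416] -/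
theorem isDomain_quotient_coordStrictTransformIdeal {I : Ideal (MvPolynomial σ S)} [I.IsPrime]
    (h : (X i₀ : MvPolynomial σ S) ∉ I) :
    IsDomain (MvPolynomial σ S ⧸ coordStrictTransformIdeal S A i₀ I) := by
  have hb : Ideal.Quotient.mk I (X i₀ : MvPolynomial σ S) ≠ 0 := by
    rwa [Ne, Ideal.Quotient.eq_zero_iff_mem]
  haveI : IsDomain (Localization.Away (Ideal.Quotient.mk I (X i₀ : MvPolynomial σ S))) :=
    IsLocalization.isDomain_localization (powers_le_nonZeroDivisors_of_noZeroDivisors hb)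
  exact (quotientCoordStrictTransformIdealEquiv S A i₀ I).toMulEquiv.isDomain

/-- **The strict transform of an integral closed subscheme is integral or empty on the chart**:
for a prime ideal `I`, the strict transform ideal `I^st` is prime (if `X_{i₀} ∉ I`) or `⊤`
(if `X_{i₀} ∈ I`). [cite: GortzWedhorn2020, Prop. 13.96 (2) and p. 416] -/
theorem coordStrictTransformIdeal_isPrime_or_eq_top {I : Ideal (MvPolynomial σ S)} [I.IsPrime] :
    (coordStrictTransformIdeal S A i₀ I).IsPrime ∨ coordStrictTransformIdeal S A i₀ I = ⊤ := by
  by_cases h : (X i₀ : MvPolynomial σ S) ∈ I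
  · exact Or.inr (coordStrictTransformIdeal_eq_top_of_X_mem S A i₀ h)
  · left
    haveI := isDomain_quotient_coordStrictTransformIdeal S A i₀ h
    exact (Ideal.Quotient.isDomain_iff_prime _).mp inferInstance

/-! ### The criterion has content: an example where the proper transforms do NOT define the strict transform

`σ = {0, 1, 2}` (variables `x, y, z`), centre `A = {x, y}` (the `z`-axis of `𝔸³`), chart over `x`
(`y ↦ x y`), and `Z = V(y - x², y z)` (the parabola `{y = x², z = 0}` together with the `z`-axis).
The proper transforms of the two generators are `y - x` and `y z`; modulo them `x · z ≡ 0` but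
`z ≢ 0`, so `x` is a zero-divisor and `(y - x, y z) = (y - x) ∩ (x, y) ⊋`-cuts out the strict
transform `V(y - x, z)` PLUS the line `{x = y = 0}` inside the exceptional divisor. -/

section Example

variable (S : Type u) [CommRing S]

/-- The centre `{x, y}` of the example contains `x`. [folklore] -/
private theorem zero_mem_pair : (0 : Fin 3) ∈ ({0, 1} : Set (Fin 3)) := by simp

/-- The centre `{x, y}` of the example contains `y`. [folklore] -/
private theorem one_mem_pair : (1 : Fin 3) ∈ ({0, 1} : Set (Fin 3)) := by simp

/-- The proper transform of `y - x²` on the chart over `x` of the blow-up of the `z`-axis is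
`y - x`. [cite: Hu2025, §5 Def. 5.4] -/
theorem coordProperTransform_example_parabola [Nontrivial S] :
    coordProperTransform S ({0, 1} : Set (Fin 3)) 0 (X 1 - X 0 ^ 2 : MvPolynomial (Fin 3) S) =
      X 1 - X 0 := by
  have hde : (Finsupp.single (1 : Fin 3) 1) ≠ Finsupp.single 0 2 := by
    intro h
    have h1 := DFunLike.congr_fun h 1
    simp at h1
  rw [X_pow_eq_monomial, show (X 1 : MvPolynomial (Fin 3) S) = monomial (Finsupp.single 1 1) 1 from rfl,
    coordProperTransform_monomial_sub_monomial S ({0, 1} : Set (Fin 3)) 0 hde one_ne_zero one_ne_zero,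
    centreDegree_single_of_mem _ (one_mem_pair), centreDegree_single_of_mem _ (zero_mem_pair),
    Finsupp.erase_single_ne (by decide), Finsupp.erase_single]
  norm_num

/-- The proper transform of the monomial `y z` is `y z`. [cite: Hu2025, §5 Def. 5.4] -/
theorem coordProperTransform_example_monomial :
    coordProperTransform S ({0, 1} : Set (Fin 3)) 0 (X 1 * X 2 : MvPolynomial (Fin 3) S) =
      X 1 * X 2 := by
  rw [show (X 1 * X 2 : MvPolynomial (Fin 3) S) =
      monomial (Finsupp.single 1 1 + Finsupp.single 2 1) 1 from by
        rw [X, X, monomial_mul, one_mul],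
    coordProperTransform_monomial, Finsupp.erase_add, Finsupp.erase_single_ne (by decide),
    Finsupp.erase_single_ne (by decide)]

/-- `x · z` lies in the ideal of the proper transforms: `x z = y z - z (y - x)`. [folklore] -/
theorem X_mul_X_mem_span_example :
    (X 0 * X 2 : MvPolynomial (Fin 3) S) ∈
      Ideal.span ({X 1 - X 0, X 1 * X 2} : Set (MvPolynomial (Fin 3) S)) := by
  have h1 : (X 1 - X 0 : MvPolynomial (Fin 3) S) ∈
      Ideal.span ({X 1 - X 0, X 1 * X 2} : Set (MvPolynomial (Fin 3) S)) :=
    Ideal.subset_span (Set.mem_insert _ _)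
  have h2 : (X 1 * X 2 : MvPolynomial (Fin 3) S) ∈
      Ideal.span ({X 1 - X 0, X 1 * X 2} : Set (MvPolynomial (Fin 3) S)) :=
    Ideal.subset_span (Set.mem_insert_of_mem _ (Set.mem_singleton _))
  have : (X 0 * X 2 : MvPolynomial (Fin 3) S) = X 1 * X 2 - X 2 * (X 1 - X 0) := by ring
  rw [this]
  exact Ideal.sub_mem _ h2 (Ideal.mul_mem_left _ _ h1)

/-- `z` does NOT lie in the ideal of the proper transforms (it survives the substitution
`x, y ↦ 0`). [folklore] -/
theorem X_not_mem_span_example [Nontrivial S] :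
    (X 2 : MvPolynomial (Fin 3) S) ∉
      Ideal.span ({X 1 - X 0, X 1 * X 2} : Set (MvPolynomial (Fin 3) S)) := by
  intro h
  let ev : MvPolynomial (Fin 3) S →ₐ[S] MvPolynomial (Fin 3) S :=
    aeval fun i => if i = 2 then X 2 else 0
  have hker : Ideal.span ({X 1 - X 0, X 1 * X 2} : Set (MvPolynomial (Fin 3) S)) ≤
      RingHom.ker (ev : MvPolynomial (Fin 3) S →+* MvPolynomial (Fin 3) S) := by
    rw [Ideal.span_le]
    rintro q hq
    rcases hq with rfl | rfl
    · simp [ev]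
    · simp [ev]
  have h0 : ev (X 2) = 0 := hker h
  have h2 : ev (X 2) = X 2 := by simp [ev]
  rw [h2] at h0
  exact X_ne_zero _ h0

/-- **The example**: for `Z = V(y - x², y z) ⊂ 𝔸³_S` and the blow-up of the `z`-axis, on the chart
over `x` the exceptional equation `x` is a ZERO-DIVISOR modulo the proper transforms
`(y - x, y z)` of the two defining equations, so by the criterion they do not generate the strict
transform ideal: `(G)^st ≠ (f_𝔙 : f ∈ G)`. [cite: GortzWedhorn2020, Prop. 13.96 (2) and p. 416] -/
theorem coordStrictTransformIdeal_ne_span_example [Nontrivial S] :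
    coordStrictTransformIdeal S ({0, 1} : Set (Fin 3)) 0
        (Ideal.span ({X 1 - X 0 ^ 2, X 1 * X 2} : Set (MvPolynomial (Fin 3) S))) ≠
      Ideal.span (coordProperTransform S ({0, 1} : Set (Fin 3)) 0 ''
        ({X 1 - X 0 ^ 2, X 1 * X 2} : Set (MvPolynomial (Fin 3) S))) := by
  have himage : coordProperTransform S ({0, 1} : Set (Fin 3)) 0 ''
      ({X 1 - X 0 ^ 2, X 1 * X 2} : Set (MvPolynomial (Fin 3) S)) = {X 1 - X 0, X 1 * X 2} := by
    rw [Set.image_insert_eq, Set.image_singleton, coordProperTransform_example_parabola,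
      coordProperTransform_example_monomial]
  rw [Ne, coordStrictTransformIdeal_span_eq_iff S _ 0 zero_mem_pair, himage]
  intro h
  exact X_not_mem_span_example S (h _ (X_mul_X_mem_span_example S))

/-- Equivalently: `z` lies in the strict transform ideal but not in the ideal of the proper
transforms — `V(y - x, y z)` is the strict transform `V(y - x, z)` together with the extra line
`{x = y = 0}` inside the exceptional divisor. [cite: GortzWedhorn2020, Prop. 13.96 (2) and p. 416] -/
theorem X_mem_coordStrictTransformIdeal_example [Nontrivial S] :
    (X 2 : MvPolynomial (Fin 3) S) ∈ coordStrictTransformIdeal S ({0, 1} : Set (Fin 3)) 0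
        (Ideal.span ({X 1 - X 0 ^ 2, X 1 * X 2} : Set (MvPolynomial (Fin 3) S))) ∧
      (X 2 : MvPolynomial (Fin 3) S) ∉ Ideal.span (coordProperTransform S ({0, 1} : Set (Fin 3)) 0 ''
        ({X 1 - X 0 ^ 2, X 1 * X 2} : Set (MvPolynomial (Fin 3) S))) := by
  have himage : coordProperTransform S ({0, 1} : Set (Fin 3)) 0 ''
      ({X 1 - X 0 ^ 2, X 1 * X 2} : Set (MvPolynomial (Fin 3) S)) = {X 1 - X 0, X 1 * X 2} := by
    rw [Set.image_insert_eq, Set.image_singleton, coordProperTransform_example_parabola,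
      coordProperTransform_example_monomial]
  refine ⟨mem_of_X_mul_mem S _ 0 ?_, by rw [himage]; exact X_not_mem_span_example S⟩
  refine span_image_coordProperTransform_le S _ 0 zero_mem_pair Ideal.subset_span ?_
  rw [himage]
  exact X_mul_X_mem_span_example S

end Example

end Literature.AlgebraicGeometry.Resolution

end
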